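import Summits.KontsevichZagierPeriods.KontsevichZagierPeriods.Theorems.SoloBlindLevelSix
import Summits.KontsevichZagierPeriods.KontsevichZagierPeriods.Theorems.SoloBlindMixedDuplication
import HarnessLib

/-!
# Level 8: duplication and mixed duplication collapse `V₈` to five generators

At level `8` the ten `S₃`-orbits of exponent triples (first kind `{1,1,6}, {1,2,5}, {1,3,4},
{2,2,4}, {2,3,3}`; second kind `{2,7,7}, {3,6,7}, {4,5,7}, {4,6,6}, {5,5,6}`) form FOUR
Deligne–Koblitz–Ogus classes. Inside the Kontsevich–Zagier rules the merging relations are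
Legendre duplication `β(a,a) ∝ β(a,½)` (`SoloBlindDuplication`) and the mixed duplication
`β(a,a+½) ∝ β(2a,½)` (`SoloBlindMixedDuplication`) at `a = 1/8, 3/8`, composed with the orbit
moves:

* class `A = {1,1,6} ∪ {1,3,4} ∪ {2,3,3}` (generator `β(1/8,1/8)`),
* class `B = {2,7,7} ∪ {4,5,7} ∪ {5,5,6}` (generator `β(7/8,7/8)`),
* class `C = {1,2,5} ∪ {2,2,4}` (generator `β(1/4,1/4)`; the merge is MIXED duplication),
* class `D = {3,6,7} ∪ {4,6,6}` (generator `β(3/4,3/4)`; mixed duplication).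

`levelSpan_eight_eq`: `V₈ = K₀ x_π + K₀ β(1/8,1/8) + K₀ β(7/8,7/8) + K₀ β(1/4,1/4) + K₀ β(3/4,3/4)`;
`kz_levelEight`: linear independence of the five periods over `K₀` (Wolfart–Wüstholz) implies
injectivity of the period map on `V₈`.
-/

noncomputable section

open Set

namespace Summit.KontsevichZagierPeriods.KontsevichZagierPeriods.Theorems

namespace SoloBlind

open Literature.NumberTheory.Transcendental
open Literature.NumberTheory.Transcendental.KZ

/-- Mixed duplication as a proportionality: `[β(a,a+½)] ≐ [β(2a,½)]`. -/
theorem betaQ_propTo_mixed {a : ℚ} (ha : 0 < a) :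
    PropTo (betaQ a (a + 1 / 2)) (betaQ (2 * a) (1 / 2)) :=
  ⟨duplCoeff a, duplCoeff_ne_zero a, betaQ_mixed_dupl a ha⟩

/-- Orbit representatives at level 8. -/
def reps8 : Finset (ℕ × ℕ) :=
  {(1, 1), (1, 2), (1, 3), (2, 2), (2, 3), (7, 7), (6, 7), (5, 7), (6, 6), (5, 6)}

/-- `reps8` meets all ten `S₃`-orbits at level 8. -/
theorem represents8 : Represents 8 reps8 := by decide

/-- The five level-8 generators `x_π, β(1/8,1/8), β(7/8,7/8), β(1/4,1/4), β(3/4,3/4)`. -/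
def eightGens : Fin 5 → Q :=
  ![xPi, betaQ (1 / 8) (1 / 8), betaQ (7 / 8) (7 / 8), betaQ (1 / 4) (1 / 4), betaQ (3 / 4) (3 / 4)]

/-- The span of the five generators. -/
def eightSpan : Submodule K₀ Q := Submodule.span K₀ (range eightGens)

/-- `β(1/8,1/8) ∈ ⟨eightGens⟩`. -/
theorem e11_mem : betaQ (1 / 8) (1 / 8) ∈ eightSpan := Submodule.subset_span ⟨1, rfl⟩

/-- `β(7/8,7/8) ∈ ⟨eightGens⟩`. -/
theorem e77_mem : betaQ (7 / 8) (7 / 8) ∈ eightSpan := Submodule.subset_span ⟨2, rfl⟩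

/-- `β(1/4,1/4) ∈ ⟨eightGens⟩`. -/
theorem e22_mem : betaQ (1 / 4) (1 / 4) ∈ eightSpan := Submodule.subset_span ⟨3, rfl⟩

/-- `β(3/4,3/4) ∈ ⟨eightGens⟩`. -/
theorem e66_mem : betaQ (3 / 4) (3 / 4) ∈ eightSpan := Submodule.subset_span ⟨4, rfl⟩

/-- `β(1/8,1/2) ∈ ⟨eightGens⟩` (duplication at `1/8`). -/
theorem e14_mem : betaQ (1 / 8) (1 / 2) ∈ eightSpan :=
  (betaQ_propTo_dupl (a := 1 / 8) (by norm_num)).symm.mem e11_mem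

/-- `β(1/8,3/8) ∈ ⟨eightGens⟩` (orbit `{1,3,4}`). -/
theorem e13_mem : betaQ (1 / 8) (3 / 8) ∈ eightSpan := by
  have h := propTo_of_sameOrbit (N := 8) (p := (1, 4)) (q := (1, 3)) (by decide) (by decide)
    (by decide)
  norm_num at h
  exact h.mem e14_mem

/-- `β(3/8,1/2) ∈ ⟨eightGens⟩` (orbit `{1,3,4}`). -/
theorem e34_mem : betaQ (3 / 8) (1 / 2) ∈ eightSpan := by
  have h := propTo_of_sameOrbit (N := 8) (p := (1, 4)) (q := (3, 4)) (by decide) (by decide)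
    (by decide)
  norm_num at h
  exact h.mem e14_mem

/-- `β(3/8,3/8) ∈ ⟨eightGens⟩` (duplication at `3/8`). -/
theorem e33_mem : betaQ (3 / 8) (3 / 8) ∈ eightSpan :=
  (betaQ_propTo_dupl (a := 3 / 8) (by norm_num)).mem e34_mem

/-- `β(1/4,3/8) ∈ ⟨eightGens⟩` (orbit `{2,3,3}`). -/
theorem e23_mem : betaQ (1 / 4) (3 / 8) ∈ eightSpan := by
  have h := propTo_of_sameOrbit (N := 8) (p := (3, 3)) (q := (2, 3)) (by decide) (by decide)
    (by decide)
  norm_num at h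
  exact h.mem e33_mem

/-- `β(1/4,1/2) ∈ ⟨eightGens⟩` (orbit `{2,2,4}`). -/
theorem e24_mem : betaQ (1 / 4) (1 / 2) ∈ eightSpan := by
  have h := propTo_of_sameOrbit (N := 8) (p := (2, 2)) (q := (2, 4)) (by decide) (by decide)
    (by decide)
  norm_num at h
  exact h.mem e22_mem

/-- `β(1/8,5/8) ∈ ⟨eightGens⟩` (MIXED duplication at `1/8`). -/
theorem e15_mem : betaQ (1 / 8) (5 / 8) ∈ eightSpan := by
  have h := betaQ_propTo_mixed (a := 1 / 8) (by norm_num)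
  norm_num at h
  exact h.mem e24_mem

/-- `β(1/8,1/4) ∈ ⟨eightGens⟩` (orbit `{1,2,5}`). -/
theorem e12_mem : betaQ (1 / 8) (1 / 4) ∈ eightSpan := by
  have h := propTo_of_sameOrbit (N := 8) (p := (1, 5)) (q := (1, 2)) (by decide) (by decide)
    (by decide)
  norm_num at h
  exact h.mem e15_mem

/-- `β(7/8,1/2) ∈ ⟨eightGens⟩` (duplication at `7/8`). -/
theorem e74_mem : betaQ (7 / 8) (1 / 2) ∈ eightSpan :=
  (betaQ_propTo_dupl (a := 7 / 8) (by norm_num)).symm.mem e77_mem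

/-- `β(5/8,7/8) ∈ ⟨eightGens⟩` (orbit `{4,5,7}`). -/
theorem e57_mem : betaQ (5 / 8) (7 / 8) ∈ eightSpan := by
  have h := propTo_of_sameOrbit (N := 8) (p := (7, 4)) (q := (5, 7)) (by decide) (by decide)
    (by decide)
  norm_num at h
  exact h.mem e74_mem

/-- `β(5/8,1/2) ∈ ⟨eightGens⟩` (orbit `{4,5,7}`). -/
theorem e54_mem : betaQ (5 / 8) (1 / 2) ∈ eightSpan := by
  have h := propTo_of_sameOrbit (N := 8) (p := (7, 4)) (q := (5, 4)) (by decide) (by decide)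
    (by decide)
  norm_num at h
  exact h.mem e74_mem

/-- `β(5/8,5/8) ∈ ⟨eightGens⟩` (duplication at `5/8`). -/
theorem e55_mem : betaQ (5 / 8) (5 / 8) ∈ eightSpan :=
  (betaQ_propTo_dupl (a := 5 / 8) (by norm_num)).mem e54_mem

/-- `β(5/8,3/4) ∈ ⟨eightGens⟩` (orbit `{5,5,6}`). -/
theorem e56_mem : betaQ (5 / 8) (3 / 4) ∈ eightSpan := by
  have h := propTo_of_sameOrbit (N := 8) (p := (5, 5)) (q := (5, 6)) (by decide) (by decide)
    (by decide)
  norm_num at h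
  exact h.mem e55_mem

/-- `β(3/4,1/2) ∈ ⟨eightGens⟩` (orbit `{4,6,6}`). -/
theorem e64_mem : betaQ (3 / 4) (1 / 2) ∈ eightSpan := by
  have h := propTo_of_sameOrbit (N := 8) (p := (6, 6)) (q := (6, 4)) (by decide) (by decide)
    (by decide)
  norm_num at h
  exact h.mem e66_mem

/-- `β(3/8,7/8) ∈ ⟨eightGens⟩` (MIXED duplication at `3/8`). -/
theorem e37_mem : betaQ (3 / 8) (7 / 8) ∈ eightSpan := by
  have h := betaQ_propTo_mixed (a := 3 / 8) (by norm_num)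
  norm_num at h
  exact h.mem e64_mem

/-- `β(3/4,7/8) ∈ ⟨eightGens⟩` (orbit `{3,6,7}`). -/
theorem e67_mem : betaQ (3 / 4) (7 / 8) ∈ eightSpan := by
  have h := propTo_of_sameOrbit (N := 8) (p := (3, 7)) (q := (6, 7)) (by decide) (by decide)
    (by decide)
  norm_num at h
  exact h.mem e37_mem

/-- Every generator of the orbit description of `V₈` lies in `⟨eightGens⟩`. -/
theorem levelGens_eight_mem (i : Option ↥reps8) : levelGens 8 reps8 i ∈ eightSpan := by
  rcases i with _ | ⟨⟨k, l⟩, hr⟩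
  · exact Submodule.subset_span ⟨0, rfl⟩
  · simp only [reps8, Finset.mem_insert, Finset.mem_singleton, Prod.mk.injEq] at hr
    simp only [levelGens]
    rcases hr with ⟨rfl, rfl⟩ | ⟨rfl, rfl⟩ | ⟨rfl, rfl⟩ | ⟨rfl, rfl⟩ | ⟨rfl, rfl⟩ | ⟨rfl, rfl⟩ |
      ⟨rfl, rfl⟩ | ⟨rfl, rfl⟩ | ⟨rfl, rfl⟩ | ⟨rfl, rfl⟩
    · norm_num; exact e11_mem
    · norm_num; exact e12_mem
    · norm_num; exact e13_mem
    · norm_num; exact e22_mem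
    · norm_num; exact e23_mem
    · norm_num; exact e77_mem
    · norm_num; exact e67_mem
    · norm_num; exact e57_mem
    · norm_num; exact e66_mem
    · norm_num; exact e56_mem

/-- **`V₈ ⊆ ⟨x_π, β(1/8,1/8), β(7/8,7/8), β(1/4,1/4), β(3/4,3/4)⟩`.** -/
theorem levelSpan_eight_le : levelSpan 8 ≤ eightSpan := by
  rw [levelSpan_eq (by norm_num) represents8]
  exact Submodule.span_le.mpr (by rintro x ⟨i, rfl⟩; exact levelGens_eight_mem i)

/-- The five generators lie in `V₈`, so `V₈` IS their span. -/
theorem levelSpan_eight_eq : levelSpan 8 = eightSpan := by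
  refine le_antisymm levelSpan_eight_le (Submodule.span_le.mpr ?_)
  rintro x ⟨i, rfl⟩
  fin_cases i
  · exact Submodule.subset_span (mem_insert _ _)
  · exact Submodule.subset_span (mem_insert_of_mem _ ⟨1, 1, 0, 0, le_rfl, by norm_num, le_rfl,
      by norm_num, by norm_num [eightGens]⟩)
  · exact Submodule.subset_span (mem_insert_of_mem _ ⟨7, 7, 0, 0, by norm_num, by norm_num,
      by norm_num, by norm_num, by norm_num [eightGens]⟩)
  · exact Submodule.subset_span (mem_insert_of_mem _ ⟨2, 2, 0, 0, by norm_num, by norm_num,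
      by norm_num, by norm_num, by norm_num [eightGens]⟩)
  · exact Submodule.subset_span (mem_insert_of_mem _ ⟨6, 6, 0, 0, by norm_num, by norm_num,
      by norm_num, by norm_num, by norm_num [eightGens]⟩)

/-- **Level 8.** If `π, B(1/8,1/8), B(7/8,7/8), B(1/4,1/4), B(3/4,3/4)` are linearly independent
over `K₀ = ℚ̄ ∩ ℝ` (Wolfart–Wüstholz: four distinct Deligne–Koblitz–Ogus classes and `π`), then
the period map is injective on `V₈`: every `K₀`-linear relation among level-8 Beta words and `π`
with vanishing period follows from the three Kontsevich–Zagier rules. -/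
theorem kz_levelEight (h : LinearIndependent K₀ fun i => evalQ (eightGens i)) {z : Q}
    (hz : z ∈ levelSpan 8) (h0 : evalQ z = 0) : z = 0 := by
  obtain ⟨c, rfl⟩ := (Submodule.mem_span_range_iff_exists_fun K₀).mp (levelSpan_eight_le hz)
  have hsum : ∑ i, c i • evalQ (eightGens i) = 0 := by
    rw [map_sum] at h0
    simpa only [evalQ_smul, IntermediateField.smul_def, smul_eq_mul] using h0
  have hc : ∀ i, c i = 0 := Fintype.linearIndependent_iff.mp h c hsum
  simp [hc]

/-- The period map is injective on `V₈` (same hypothesis). -/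
theorem evalQ_injOn_levelSpan_eight (h : LinearIndependent K₀ fun i => evalQ (eightGens i)) :
    InjOn evalQ (levelSpan 8) := fun x hx y hy hxy => sub_eq_zero.mp
  (kz_levelEight h ((levelSpan 8).sub_mem hx hy) (by rw [map_sub, hxy, sub_self]))

/-- In particular `[β(1/8,1/4)] ∈ K₀ [β(1/4,1/4)]`-span facts: `β(1/8,1/4) ≐ β(1/4,1/4)`
(`B(1/8,1/4)/B(1/4,1/4) ∈ ℚ̄`, the level-8 coincidence invisible to the `S₃`-orbits). -/
theorem betaQ_propTo_eighth_quarter : PropTo (betaQ (1 / 8) (1 / 4)) (betaQ (1 / 4) (1 / 4)) := by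
  have h1 := propTo_of_sameOrbit (N := 8) (p := (1, 5)) (q := (1, 2)) (by decide) (by decide)
    (by decide)
  have h2 := betaQ_propTo_mixed (a := 1 / 8) (by norm_num)
  have h3 := propTo_of_sameOrbit (N := 8) (p := (2, 2)) (q := (2, 4)) (by decide) (by decide)
    (by decide)
  norm_num at h1 h2 h3
  exact (h1.trans h2).trans h3

end SoloBlind

end Summit.KontsevichZagierPeriods.KontsevichZagierPeriods.Theorems
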